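import Summits.ResolutionOfSingularities.ResolutionOfSingularities.Theorems.WildTwistedToricLU4
import Literature.AlgebraicGeometry.Resolution.InvariantLatticeToricChart
import Literature.AlgebraicGeometry.Resolution.ToricChartRegularity
import Literature.AlgebraicGeometry.Resolution.ArithmeticalThreefoldsLocalFrameDim
import Literature.AlgebraicGeometry.Resolution.MonoidalTransformStep
import HarnessLib

/-!
# WildTwistedToricLU (5/7) — THE ENGINE: the twisted toric chart of the invariant ring

Node «TwistedToricCut» (decomp-res lens-1 g33), tree file 5/7.

* `twZ x Φ N p m = x^m Φ^{−⟨m,N⟩/p}` — twisted monomials with INTEGER exponents `m ∈ ℤ^d` (field level), the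
  index-`p` lattice `twLattice N p = {m : p ∣ ⟨m,N⟩}`, `σ`-invariance, multiplicativity, valuation, fraction form;
* `exists_twisted_toric_chart` — **THE ENGINE** (rank-one-cocycle kind, every `d`, every `p`): in the setting of file 4
  with `σ^p = 1` and NORM ONE, there is a finite set `y ⊆ K ∩ O` (the twisted monomials `z_{nᵢ}` on a lattice basis
  `nᵢ` of `twLattice` adapted to `v`, tree `exists_latticeBasis_nonneg_of_nsmul_mem`) such that the model
  `(M ⊓ K)[y]` is REGULAR at the centre of `O` — by the structure theorem (file 4), the tree's toric chart
  regularity `isRegularLocalRing_locAtCentre_adjoin_monomials` and dimension invariance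
  `ringKrullDim_locAtCentre_closure_eq` (all BY NAME).
-/

noncomputable section

open IsLocalRing Polynomial Literature.AlgebraicGeometry.Resolution
open Summit.ResolutionOfSingularities.ResolutionOfSingularities.Theorems.InvariantDescentLU
open Summit.ResolutionOfSingularities.ResolutionOfSingularities.Theorems.InertDescentLU
open Summit.ResolutionOfSingularities.ResolutionOfSingularities.Theorems.WildReflectionLU
open Summit.ResolutionOfSingularities.ResolutionOfSingularities.Theorems.WildLogDiagonalLU

universe u

namespace Summit.ResolutionOfSingularities.ResolutionOfSingularities.Theorems.WildTwistedToricLU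

variable {E : Type u} [Field E] (O : ValuationSubring E)

section TwistedMonomials

variable {d : ℕ}

/-- The pairing `m ↦ ⟨m,N⟩ = Σⱼ Nⱼ mⱼ` on `ℤ^d`, as an additive homomorphism. -/
def pairHom (N : Fin d → ℤ) : (Fin d → ℤ) →+ ℤ where
  toFun m := ∑ j, N j * m j
  map_zero' := by simp
  map_add' m m' := by simp [mul_add, Finset.sum_add_distrib]

/-- `pairHom N m = Σⱼ Nⱼ mⱼ`. -/
theorem pairHom_apply (N : Fin d → ℤ) (m : Fin d → ℤ) : pairHom N m = ∑ j, N j * m j := rfl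

/-- On exponents `β ∈ ℕ^d`: `pairHom N β = pair N β`. -/
theorem pairHom_natCast (N : Fin d → ℤ) (β : Fin d →₀ ℕ) :
    pairHom N (fun j => (β j : ℤ)) = pair N β := rfl

/-- The index-`p` lattice `L = {m ∈ ℤ^d : p ∣ ⟨m,N⟩}` of `σ`-invariant twisted exponents. -/
def twLattice (N : Fin d → ℤ) (p : ℕ) : AddSubgroup (Fin d → ℤ) :=
  (AddSubgroup.zmultiples (p : ℤ)).comap (pairHom N)

/-- Membership in the twisted lattice. -/
theorem mem_twLattice {N : Fin d → ℤ} {p : ℕ} {m : Fin d → ℤ} :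
    m ∈ twLattice N p ↔ (p : ℤ) ∣ pairHom N m := by
  rw [twLattice, AddSubgroup.mem_comap, Int.mem_zmultiples_iff]

/-- `p ℤ^d ⊆ L`. -/
theorem nsmul_mem_twLattice (N : Fin d → ℤ) (p : ℕ) (m : Fin d → ℤ) : p • m ∈ twLattice N p := by
  rw [mem_twLattice, map_nsmul, nsmul_eq_mul]
  exact Dvd.intro _ rfl

/-- The twisted monomial with integer exponents `z_m = x^m · Φ^{−⟨m,N⟩/p}` (an element of the field). -/
def twZ (x : Fin d → E) (Φ : E) (N : Fin d → ℤ) (p : ℕ) (m : Fin d → ℤ) : E :=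
  (∏ j, x j ^ m j) * Φ ^ (-(pairHom N m / p))

/-- On `ℕ`-exponents the field-level and the abstract twisted monomials agree. -/
theorem twZ_natCast (x : Fin d → E) (Φ : E) (N : Fin d → ℤ) (p : ℕ) (β : Fin d →₀ ℕ) :
    twZ x Φ N p (fun j => (β j : ℤ)) = (∏ j, x j ^ (β j)) * Φ ^ (-(pair N β / p)) := by
  rw [twZ, pairHom_natCast]
  simp only [zpow_natCast]

/-- `∏ⱼ U^{eⱼ} = U^{Σ eⱼ}` for `U ≠ 0`. [folklore] -/
theorem prod_zpow_eq_zpow_sum₀ {U : E} (hU : U ≠ 0) {ι : Type*} (s : Finset ι) (e : ι → ℤ) :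
    ∏ i ∈ s, U ^ e i = U ^ ∑ i ∈ s, e i := by
  classical
  induction s using Finset.induction_on with
  | empty => simp
  | insert a s ha ih => rw [Finset.prod_insert ha, Finset.sum_insert ha, ih, zpow_add₀ hU]

/-- **Invariance**: `σ z_m = z_m` for `m ∈ L`, when `σ xⱼ = xⱼ U^{Nⱼ}` and `σ Φ = Φ U^p`. [this node] -/
theorem apply_twZ {σ : E ≃+* E} {x : Fin d → E} {U Φ : E} {N : Fin d → ℤ} {p : ℕ}
    (hU : U ≠ 0) (hσx : ∀ j, σ (x j) = x j * U ^ N j) (hσΦ : σ Φ = Φ * U ^ p) {m : Fin d → ℤ}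
    (hm : (p : ℤ) ∣ pairHom N m) : σ (twZ x Φ N p m) = twZ x Φ N p m := by
  have h1 : σ (∏ j, x j ^ m j) = (∏ j, x j ^ m j) * U ^ pairHom N m := by
    rw [map_prod, pairHom_apply, ← prod_zpow_eq_zpow_sum₀ hU, ← Finset.prod_mul_distrib]
    exact Finset.prod_congr rfl fun j _ => by rw [map_zpow₀, hσx, mul_zpow, ← zpow_mul]
  have h2 : σ (Φ ^ (-(pairHom N m / p))) = Φ ^ (-(pairHom N m / p)) * U ^ (-(pairHom N m)) := by
    rw [map_zpow₀, hσΦ, mul_zpow, ← zpow_natCast, ← zpow_mul]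
    congr 2
    rw [mul_neg, Int.mul_ediv_cancel' hm]
  rw [twZ, map_mul, h1, h2, mul_mul_mul_comm, ← zpow_add₀ hU, add_neg_cancel, zpow_zero, mul_one]

/-- **Multiplicativity** on the lattice: `z_{m+m′} = z_m z_{m′}` when `p ∣ ⟨m,N⟩`. [this node] -/
theorem twZ_add {x : Fin d → E} (hx0 : ∀ j, x j ≠ 0) {Φ : E} (hΦ0 : Φ ≠ 0) (N : Fin d → ℤ) {p : ℕ}
    (hp : 0 < p) {m : Fin d → ℤ} (hm : (p : ℤ) ∣ pairHom N m) (m' : Fin d → ℤ) :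
    twZ x Φ N p (m + m') = twZ x Φ N p m * twZ x Φ N p m' := by
  have hp0 : (p : ℤ) ≠ 0 := by exact_mod_cast hp.ne'
  have h1 : (∏ j, x j ^ (m + m') j) = (∏ j, x j ^ m j) * ∏ j, x j ^ m' j := by
    rw [← Finset.prod_mul_distrib]
    exact Finset.prod_congr rfl fun j _ => by rw [Pi.add_apply, zpow_add₀ (hx0 j)]
  have h2 : -(pairHom N (m + m') / (p : ℤ)) = -(pairHom N m / p) + -(pairHom N m' / p) := by
    rw [map_add, Int.add_ediv_of_dvd_left hm]; ring
  rw [twZ, h1, h2, zpow_add₀ hΦ0, twZ, twZ]; ring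

/-- `z_{c • m} = z_m^c` for `m ∈ L`, `c ∈ ℕ`. [this node] -/
theorem twZ_nsmul {x : Fin d → E} (hx0 : ∀ j, x j ≠ 0) {Φ : E} (hΦ0 : Φ ≠ 0) (N : Fin d → ℤ) {p : ℕ}
    (hp : 0 < p) {m : Fin d → ℤ} (hm : (p : ℤ) ∣ pairHom N m) (c : ℕ) :
    twZ x Φ N p (c • m) = twZ x Φ N p m ^ c := by
  induction c with
  | zero => simp [twZ]
  | succ c ih =>
    have hcm : (p : ℤ) ∣ pairHom N (c • m) := by rw [map_nsmul, nsmul_eq_mul]; exact hm.mul_left _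
    rw [succ_nsmul, twZ_add hx0 hΦ0 N hp hcm, ih, pow_succ]

/-- `z_{Σ cᵢ • nᵢ} = ∏ z_{nᵢ}^{cᵢ}` for lattice vectors `nᵢ` and `cᵢ ∈ ℕ`. [this node] -/
theorem twZ_sum_nsmul {x : Fin d → E} (hx0 : ∀ j, x j ≠ 0) {Φ : E} (hΦ0 : Φ ≠ 0) (N : Fin d → ℤ)
    {p : ℕ} (hp : 0 < p) {r : ℕ} (n : Fin r → Fin d → ℤ) (hn : ∀ i, (p : ℤ) ∣ pairHom N (n i))
    (c : Fin r → ℕ) : twZ x Φ N p (∑ i, c i • n i) = ∏ i, twZ x Φ N p (n i) ^ c i := by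
  classical
  suffices h : ∀ s : Finset (Fin r), twZ x Φ N p (∑ i ∈ s, c i • n i) = ∏ i ∈ s, twZ x Φ N p (n i) ^ c i from
    h Finset.univ
  intro s
  induction s using Finset.induction_on with
  | empty => simp [twZ]
  | insert a s ha ih =>
    have hdiv : (p : ℤ) ∣ pairHom N (c a • n a) := by
      rw [map_nsmul, nsmul_eq_mul]; exact (hn a).mul_left _
    rw [Finset.sum_insert ha, Finset.prod_insert ha, twZ_add hx0 hΦ0 N hp hdiv, ih,
      twZ_nsmul hx0 hΦ0 N hp (hn a)]

/-- The valuation of a twisted monomial is that of its plain monomial (`Φ` is a unit). [this node] -/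
theorem valuation_twZ {x : Fin d → E} {Φ : E} (hΦv : O.valuation Φ = 1) (N : Fin d → ℤ) (p : ℕ)
    (m : Fin d → ℤ) : O.valuation (twZ x Φ N p m) = O.valuation (∏ j, x j ^ m j) := by
  rw [twZ, map_mul, map_zpow₀, hΦv, one_zpow, mul_one]

/-- `z^n = z^{n⁺} / z^{n⁻}` for `z ≠ 0`. [folklore] -/
theorem zpow_eq_pow_div_pow {z : E} (hz : z ≠ 0) (n : ℤ) : z ^ n = z ^ n.toNat / z ^ (-n).toNat := by
  rw [eq_div_iff (pow_ne_zero _ hz), ← zpow_natCast, ← zpow_natCast, ← zpow_add₀ hz]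
  congr 1; omega

/-- A twisted monomial is a quotient of two elements of any subring containing the `xⱼ` and `Φ`. [this node] -/
theorem exists_twZ_eq_div (B : Subring E) {x : Fin d → E} (hxB : ∀ j, x j ∈ B) (hx0 : ∀ j, x j ≠ 0) {Φ : E}
    (hΦB : Φ ∈ B) (hΦ0 : Φ ≠ 0) (N : Fin d → ℤ) (p : ℕ) (m : Fin d → ℤ) :
    ∃ a e : E, a ∈ B ∧ e ∈ B ∧ e ≠ 0 ∧ twZ x Φ N p m = a / e := by
  refine ⟨(∏ j, x j ^ (m j).toNat) * Φ ^ (-(pairHom N m / p)).toNat,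
    (∏ j, x j ^ (-(m j)).toNat) * Φ ^ (-(-(pairHom N m / p))).toNat,
    B.mul_mem (B.prod_mem fun j _ => B.pow_mem (hxB j) _) (B.pow_mem hΦB _),
    B.mul_mem (B.prod_mem fun j _ => B.pow_mem (hxB j) _) (B.pow_mem hΦB _),
    mul_ne_zero (Finset.prod_ne_zero_iff.mpr fun j _ => pow_ne_zero _ (hx0 j)) (pow_ne_zero _ hΦ0), ?_⟩
  have h1 : (∏ j, x j ^ m j) = (∏ j, x j ^ (m j).toNat) / ∏ j, x j ^ (-(m j)).toNat := by
    rw [← Finset.prod_div_distrib]; exact Finset.prod_congr rfl fun j _ => zpow_eq_pow_div_pow (hx0 j) _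
  rw [twZ, h1, zpow_eq_pow_div_pow hΦ0, div_mul_div_comm]

end TwistedMonomials

section Engine

variable {H : Finset (E ≃+* E)} {K : Subfield E} {M : Subring E}

set_option maxHeartbeats 1600000 in
/-- **THE ENGINE (rank-one-cocycle kind).**  In the setting of file 4 (`H`, `K`, `O`, `M = S[t₀]`, `T = M ⊓ K`),
with `B = M_𝔪′` regular of dimension `d`, r.s.p. `x` of non-zero elements, `σ ∈ H` with `σ^p = 1` (`p = char`),
`σ`-fixed elements in `K`, `σ xᵢ = xᵢ (1 + η)^{Nᵢ}` (`η ∈ 𝔪_B ∖ 0`) and NORM ONE `∏_{i<p} σ^i(1 + η) = 1`,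
and `A = T_𝔪′` universally catenary: there is a finite `y ⊆ K ∩ O` with `(M ⊓ K)[y]` REGULAR at the centre of
`O`.  (`y` = the twisted monomials on a `v`-adapted basis of the index-`p` lattice; structure theorem + toric chart.)
[this node; cites: CossartPiltant2008 Lemma 9.4 (53)–(54); Fulton1993Toric §2.6; tree ToricChartRegularity] -/
theorem exists_twisted_toric_chart (p : ℕ) [hp : Fact p.Prime] (hpE : (p : E) = 0)
    (h1 : (1 : E ≃+* E) ∈ H) (hmul : ∀ g ∈ H, ∀ h ∈ H, g * h ∈ H)
    (hK : ∀ z, z ∈ K ↔ ∀ h ∈ H, h z = z) (hHO : ∀ h ∈ H, ∀ z : E, z ∈ O ↔ h z ∈ O)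
    (hMO : M ≤ O.toSubring) (hMH : ∀ h ∈ H, ∀ z ∈ M, h z ∈ M) (hMreg : IsRegularLocalRing (locAtCentre M O))
    [IsNoetherianRing (M ⊓ K.toSubring : Subring E)]
    (hAuc : IsUniversallyCatenaryRing (locAtCentre (M ⊓ K.toSubring) O))
    (S : Subring E) (hSK : S ≤ K.toSubring) (hSM : S ≤ M) (t₀ : Finset E)
    (hMgen : M = Subring.closure ((S : Set E) ∪ (t₀ : Set E)))
    (hresO : ∀ y ∈ O, ∃ c ∈ S, O.valuation (y - c) < 1)
    {σ : E ≃+* E} (hσH : σ ∈ H) (hσp : σ ^ p = 1) (hσK : ∀ z, σ z = z → z ∈ K)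
    {d : ℕ} {x : Fin d → E} (hx : ∀ i, x i ∈ locAtCentre M O ∧ O.valuation (x i) < 1) (hx0 : ∀ i, x i ≠ 0)
    (hgen : ∀ b ∈ locAtCentre M O, O.valuation b < 1 →
      ∃ c : Fin d → E, (∀ i, c i ∈ locAtCentre M O) ∧ b = ∑ i, c i * x i)
    (hdim : ringKrullDim (locAtCentre M O) = d)
    {η : E} (hη : η ∈ locAtCentre M O ∧ O.valuation η < 1) (hη0 : η ≠ 0) (N : Fin d → ℤ)
    (hσx : ∀ i, σ (x i) = x i * (1 + η) ^ N i)
    (hnorm : ∏ i ∈ Finset.range p, (σ ^ i) (1 + η) = 1) :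
    ∃ y : Finset E, (↑y : Set E) ⊆ (K : Set E) ∧ (∀ z ∈ y, z ∈ O) ∧
      IsRegularLocalRing (locAtCentre (Subring.closure
        (((M ⊓ K.toSubring : Subring E) : Set E) ∪ (y : Set E))) O) := by
  classical
  set T : Subring E := M ⊓ K.toSubring with hT
  have hTM : T ≤ M := inf_le_left
  have hTO : T ≤ O.toSubring := hTM.trans hMO
  haveI hAl : IsLocalRing (locAtCentre T O) := isLocalRing_locAtCentre hTO
  haveI hBl : IsLocalRing (locAtCentre M O) := isLocalRing_locAtCentre hMO
  haveI hAn : IsNoetherianRing (locAtCentre T O) := isNoetherianRing_locAtCentre O hTO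
  haveI : IsRegularLocalRing (locAtCentre M O) := hMreg
  set A : Subring E := locAtCentre T O with hA
  set B : Subring E := locAtCentre M O with hB
  have hBO : B ≤ O.toSubring := locAtCentre_le hMO
  have hAO : A ≤ O.toSubring := locAtCentre_le hTO
  have hTA : T ≤ A := le_locAtCentre T O
  have hKfix : ∀ z ∈ K, ∀ h ∈ H, h z = z := fun z hz => (hK z).mp hz
  have hσO : ∀ z : E, z ∈ O ↔ σ z ∈ O := hHO σ hσH
  have hσM : ∀ z ∈ M, σ z ∈ M := hMH σ hσH
  have hp0 : 0 < p := hp.out.pos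
  -- the unit `U = 1 + η` and the Hilbert-90 unit `Φ`
  have hUv : O.valuation (1 + η) = 1 := valuation_one_add_eq_one O hη.2
  have hU0 : (1 + η) ≠ 0 := ne_zero_of_valuation_eq_one hUv
  have hUB : 1 + η ∈ B := B.add_mem B.one_mem hη.1
  set Φ : E := ∏ i ∈ Finset.range p, ((σ ^ i) (1 + η)) ^ i with hΦ
  have hΦB : Φ ∈ B := B.prod_mem fun i _ => B.pow_mem (pow_apply_mem_locAtCentre O hσO hσM i hUB) i
  have hΦ1 : O.valuation (Φ - 1) < 1 := by
    refine valuation_prod_sub_one_lt O _ _ fun i _ => valuation_pow_sub_one_lt O ?_ i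
    rw [map_add, map_one, add_sub_cancel_left]
    exact valuation_pow_apply_lt_one O hσO i hη.2
  have hΦv : O.valuation Φ = 1 := by
    have := valuation_one_add_eq_one O hΦ1; rwa [add_sub_cancel] at this
  have hΦ0 : Φ ≠ 0 := ne_zero_of_valuation_eq_one hΦv
  have hσΦ : σ Φ = Φ * (1 + η) ^ p := apply_twistUnit hσp hU0 hnorm
  -- THE STRUCTURE THEOREM
  have hspan := maximalIdeal_locAtCentre_inf_eq_span O p hpE h1 hmul hK hHO hMO hMH hMreg S hSK hSM t₀ hMgen
    hresO hσH hσK hx hgen hdim hη hη0 N hσx hΦB hΦ1 hσΦ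
  -- the lattice basis adapted to `v`
  let uV : Fin d → (ValuationSubring.ValueGroup O)ˣ := fun j =>
    Units.mk0 (O.valuation (x j)) ((Valuation.ne_zero_iff _).mpr (hx0 j))
  have huV : ∀ j, ((uV j : (ValuationSubring.ValueGroup O)ˣ) : ValuationSubring.ValueGroup O) =
      O.valuation (x j) := fun j => Units.val_mk0 _
  let w : Fin d → Additive (ValuationSubring.ValueGroup O)ˣ := fun j => -Additive.ofMul (uV j)
  have hw : ∀ j, 0 ≤ w j := fun j => by
    change (0 : Additive (ValuationSubring.ValueGroup O)ˣ) ≤ -Additive.ofMul (uV j)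
    rw [neg_nonneg, ← ofMul_one, Additive.ofMul_le, ← Units.val_le_val, huV, Units.val_one]
    exact (O.valuation_le_one_iff _).mpr (hBO (hx j).1)
  obtain ⟨n, hnL, -, hnat, hwn⟩ :=
    exists_latticeBasis_nonneg_of_nsmul_mem (Γ := Additive (ValuationSubring.ValueGroup O)ˣ)
      (twLattice N p) hp0 (nsmul_mem_twLattice N p) w hw
  have hnL' : ∀ i, (p : ℤ) ∣ pairHom N (n i) := fun i => mem_twLattice.mp (hnL i)
  have hval : ∀ m : Fin d → ℤ, O.valuation (∏ j, x j ^ m j) =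
      (((∏ j, uV j ^ m j : (ValuationSubring.ValueGroup O)ˣ)) : ValuationSubring.ValueGroup O) :=
    fun m => by
    rw [valuation_prod_zpow]
    simp only [Units.coe_prod, Units.val_zpow_eq_zpow_val, huV]
  have hwsum : ∀ m : Fin d → ℤ, (∑ j, m j • w j) = -Additive.ofMul (∏ j, uV j ^ m j) := fun m => by
    simp only [w, smul_neg, Finset.sum_neg_distrib, ofMul_prod, ofMul_zpow]
  -- the chart coordinates
  let y : Fin d → E := fun i => twZ x Φ N p (n i)
  have hyO : ∀ i, y i ∈ O := fun i => by
    rw [← O.valuation_le_one_iff, valuation_twZ O hΦv, hval, ← Units.val_one, Units.val_le_val,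
      ← Additive.ofMul_le, ofMul_one, ← neg_nonneg, ← hwsum]
    exact hwn i
  have hyσ : ∀ i, σ (y i) = y i := fun i => apply_twZ hU0 hσx hσΦ (hnL' i)
  have hyK : ∀ i, y i ∈ K := fun i => hσK _ (hyσ i)
  -- `y i` is a quotient of two elements of `A`
  have hyA : ∀ i, ∃ a e : A, (e : E) ≠ 0 ∧ y i = a / e := by
    intro i
    obtain ⟨a, e, haB, heB, he0, hye⟩ :=
      exists_twZ_eq_div B (fun j => (hx j).1) hx0 hΦB hΦ0 N p (n i)
    have hfix : ∀ g ∈ H, g (a / e) = a / e := fun g hg => by rw [← hye]; exact hKfix _ (hyK i) g hg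
    obtain ⟨c, hc, hNc, hN0, hce⟩ := exists_fixed_fraction h1 hmul hK
      (fun h hh z hz => apply_mem_locAtCentre O (hHO h hh) (hMH h hh) hz) haB heB he0 hfix
    have hcA : c ∈ A := mem_locAtCentre_inf_of_fixed O h1 hmul hK hMO hMH (Subring.mem_inf.mp hc).1
      (hKfix c (Subring.mem_inf.mp hc).2)
    have hNA : (∏ h ∈ H, h e) ∈ A := mem_locAtCentre_inf_of_fixed O h1 hmul hK hMO hMH
      (Subring.mem_inf.mp hNc).1 (hKfix _ (Subring.mem_inf.mp hNc).2)
    exact ⟨⟨c, hcA⟩, ⟨_, hNA⟩, hN0, by change twZ x Φ N p (n i) = c / ∏ h ∈ H, h e; rw [hye, hce]⟩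
  -- the generators `G` of `𝔪_A` are monomials in `y`
  set G : Set A := {a : A | ∃ β : Fin d →₀ ℕ, β ≠ 0 ∧ (p : ℤ) ∣ pair N β ∧
    (a : E) = (∏ j, x j ^ (β j)) * Φ ^ (-(pair N β / p))} with hG
  have hGmon : ∀ g ∈ G, ∃ c : Fin d → ℕ, ((g : A) : E) = ∏ i, y i ^ c i := by
    rintro g ⟨β, -, hβ, hg⟩
    have hβL : (fun j => (β j : ℤ)) ∈ twLattice N p := mem_twLattice.mpr (by rwa [pairHom_natCast])
    obtain ⟨c, hc⟩ := hnat _ hβL fun j => Int.natCast_nonneg _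
    refine ⟨c, ?_⟩
    rw [hg, ← twZ_natCast, hc, twZ_sum_nsmul hx0 hΦ0 N hp0 n hnL' c]
  have hdomA : ∀ a : A, a ∈ maximalIdeal A ↔ O.valuation (a : E) < 1 := fun a =>
    mem_maximalIdeal_locAtCentre_iff hTO a
  -- dimension of the chart
  have hdimA : ringKrullDim A = d := by
    rw [hA, ringKrullDim_locAtCentre_inf_eq O h1 hmul hK hHO hMH S hSK hSM t₀ hMgen]; exact hdim
  have hdom' : ∀ r : A, r ∈ maximalIdeal A → O.valuation (r : E) < 1 := fun r hr => (hdomA r).mp hr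
  have halg : ∀ z : O, ∃ q : A[X], (∃ i, q.coeff i ∉ maximalIdeal A) ∧
      O.valuation (aeval (z : E) q) < 1 := by
    intro z
    obtain ⟨c, hcS, hc⟩ := hresO z z.2
    have hcA : c ∈ A := hTA (Subring.mem_inf.mpr ⟨hSM hcS, hSK hcS⟩)
    refine ⟨X - C ⟨c, hcA⟩, ⟨1, ?_⟩, ?_⟩
    · rw [coeff_sub, coeff_X_one, coeff_C, if_neg one_ne_zero, sub_zero]
      exact (Ideal.ne_top_iff_one _).mp (maximalIdeal.isMaximal A).ne_top
    · have e : aeval (z : E) (X - C (⟨c, hcA⟩ : A)) = z - c := by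
        rw [map_sub, aeval_X, aeval_C]; rfl
      rw [e]; exact hc
  let yf : Finset E := Finset.univ.image y
  have hyf : (yf : Set E) = Set.range y := by rw [Finset.coe_image, Finset.coe_univ, Set.image_univ]
  have hb : ∀ z ∈ yf, ∃ a e : A, (e : E) ≠ 0 ∧ z = a / e := by
    intro z hz
    obtain ⟨i, -, rfl⟩ := Finset.mem_image.mp hz
    exact hyA i
  have hclO : Subring.closure ((A : Set E) ∪ ↑yf) ≤ O.toSubring := by
    refine Subring.closure_le.mpr (Set.union_subset hAO ?_)
    intro z hz
    obtain ⟨i, -, rfl⟩ := Finset.mem_image.mp (Finset.mem_coe.mp hz)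
    exact hyO i
  have hdimC : ringKrullDim (locAtCentre (Subring.closure ((A : Set E) ∪ Set.range y)) O) = d := by
    rw [← hyf, ringKrullDim_locAtCentre_closure_eq O hAuc hAO hdom' halg yf hb hclO, hdimA]
  -- the chart is regular
  have hreg := isRegularLocalRing_locAtCentre_adjoin_monomials O A hAO hdomA y hyO G hspan.symm hGmon hdimC
  -- rewrite `A[y]` at the centre as `T[y]` at the centre
  refine ⟨yf, fun z hz => ?_, fun z hz => ?_, ?_⟩
  · obtain ⟨i, -, rfl⟩ := Finset.mem_image.mp (Finset.mem_coe.mp hz); exact hyK i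
  · obtain ⟨i, -, rfl⟩ := Finset.mem_image.mp hz; exact hyO i
  · rw [hyf, ← locAtCentre_closure_locAtCentre_union T O (Set.range y)]
    exact hreg

end Engine

end Summit.ResolutionOfSingularities.ResolutionOfSingularities.Theorems.WildTwistedToricLU

end
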